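import Literature.AlgebraicGeometry.HodgeTheory.ZariskiProjectiveBundleLerayHirsch
import Literature.AlgebraicGeometry.Resolution.ExceptionalDivisorSmoothProjective
import Literature.AlgebraicGeometry.HodgeTheory.HodgeClassesBlowupBirationalInvarianceProofs
import Literature.AlgebraicGeometry.HodgeTheory.HodgeConjectureQbarVoisinProofs
import Literature.AlgebraicGeometry.HodgeTheory.HodgeClassLiftRationalHodgeMaps
import Literature.AlgebraicGeometry.HodgeTheory.AlgebraicClassesCupDivisorHolds
import Literature.AlgebraicGeometry.HodgeTheory.AlgebraicClassesHodgeTypeHolds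
import Literature.AlgebraicGeometry.HodgeTheory.HodgeTypeExteriorProduct
import Literature.AlgebraicGeometry.HodgeTheory.HyperplaneClassRational
import Literature.AlgebraicGeometry.HodgeTheory.ChernCharacterBetti
import Literature.AlgebraicGeometry.HodgeTheory.HodgeConjecture
import Literature.AlgebraicGeometry.HodgeTheory.HodgeRiemannPolarizabilityProofs
import Literature.AlgebraicGeometry.HodgeTheory.LefschetzOneOneHolds
import Literature.AlgebraicGeometry.HodgeTheory.HardLefschetzThreefold
import Literature.AlgebraicGeometry.Motives.VarietiesProjectiveSpaceProofs
import HarnessLib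

/-!
# The Hodge conjecture ascends along Zariski-locally trivial `ℙʳ`-bundles (Voisin I Lemma 7.32)

Topic `Literature/AlgebraicGeometry/HodgeTheory`. PROVED over the tree, no named fact.

For a Zariski `ℙʳ`-bundle `q : E ⟶ X` of smooth projective complex varieties
(`Resolution.IsZariskiProjectiveBundle r q`, `dim X = n`, `dim E = n + r`) on which the cup product
preserves Hodge types (true for every smooth projective variety: `cupPreservesHodgeType_of_hodgeModel`),
`HodgeConjectureFor n X → HodgeConjectureFor (n + r) E` (`ZariskiProjectiveBundle.hodgeConjectureFor`).
Proof ("`H*(ℙ(E)) = H*(X)[ξ]/(…)`", Voisin I Lemma 7.32 / Lazarsfeld II (7.5)): take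
`ζ = emb^* h ∈ N¹H²(E)` for a projective embedding (`exists_isRationalClass_lhClass`; it restricts
non-trivially to every fibre `ℙʳ ↪ E ↪ ℙᴺ`); every `y ∈ H²ᵖ(E)` is `Σ_b q^* x_b ∪ ζᵇ` (Leray–Hirsch,
`ZariskiProjectiveBundle.exists_expansion`); the maps `x ↦ q^* x ∪ ζᵇ` are rational Hodge-linear of
bidegrees `(b, b)` and jointly onto, so a rational `(p,p)`-class is `Σ_b q^* a_b ∪ ζᵇ` with `a_b`
rational of type `(p - b, p - b)` (Voisin's Hodge-class lift `exists_isRationalClass_isOfHodgeType_eq_sum`),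
hence algebraic by `HC(X)`; and `q^*` and
`∪ ζᵇ` (`cupProduct_cupPowTwo_mem_algebraicClasses`, the divisor case of Voisin II Prop. 9.20) preserve
algebraic classes — here `q^*` because `q` is smooth, hence FLAT (`map_mem_algebraicClasses_of_flat`), and
`ζ` is algebraic by Lefschetz `(1,1)` (`lefschetzOneOne_rational_holds`): no pull-back fact is used. Unconditional rungs: bundles over bases of dimension `≤ 3`
(`hodgeConjectureFor_of_dim_le_three_holds`), over `ℙᴺ`, two-step towers.

Provenance: the cell sketches `ROUTE-P1Q-Sketch-PB2` / `ROUTE-P1R-Sketch-BL` §PB of `pub/hodge-nonav`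
(seats p1 g18–g20); the Summits-side landing `Theorems/ProjectiveBundleHodgeConjecture.lean`
(namespace `…ProjectiveBundleHC`, route ask A12) carries the same ascent plus the DESCENT `HC(E) ⇒ HC(X)`
(via the Gysin readout, not repeated here). This Literature copy exists so that the discharge of the
named fact `Arapura2001_hodgeClasses_algebraic_smoothBlowup` (`HodgeClassesBlowupHolds`) can live in
`Literature/`.

## References

* [VoisinHodgeI2002] C. Voisin, Hodge Theory and Complex Algebraic Geometry I, CUP 2002, §7.1.1,
  §7.3.3 Lemma 7.32, §11.3.
* [Lazarsfeld2004PositivityII] R. Lazarsfeld, Positivity in Algebraic Geometry II, Ex. 7.1.5 (7.5).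
* [VoisinHodgeII2003] C. Voisin, Hodge Theory and Complex Algebraic Geometry II, §9.2.4 Prop. 9.20.
* [Voisin2025] C. Voisin, cycle classes on blow-ups / Hodge-class lift along rational Hodge maps, Cor. 2.12
  (as cited by the tree's `HodgeClassLiftRationalHodgeMaps`).
* [HatcherAT2002] A. Hatcher, Algebraic Topology, §3.2 p. 212.
-/

noncomputable section

open CategoryTheory AlgebraicGeometry MonoidalCategory CartesianMonoidalCategory
  Literature.AlgebraicGeometry Literature.AlgebraicGeometry.Motives
  Literature.AlgebraicGeometry.HodgeTheory Literature.AlgebraicGeometry.Resolution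
open Literature.AlgebraicTopology.SingularHomology
open Literature.AlgebraicTopology.CharacteristicClasses (cupPow cupPow_zero cupPow_succ)
open scoped Manifold

namespace Literature.AlgebraicGeometry.HodgeTheory

namespace ZariskiProjectiveBundle

/-! ## Divisor powers -/

/-- The two cup-power recursions of the tree agree: `CharacteristicClasses.cupPow ℂ x j = cupPowTwo x j`
(both are `x⁰ = 1`, `xʲ⁺¹ = xʲ ∪ x`). [cite: HatcherAT2002, §3.2 p. 212] -/
theorem cupPow_eq_cupPowTwo {Y : Type} [TopologicalSpace Y] (x : singularCohomology ℂ ℂ Y 2) :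
    ∀ j : ℕ, cupPow ℂ x j = cupPowTwo x j
  | 0 => rfl
  | j + 1 => by rw [cupPow_succ, cupPowTwo_succ, cupPow_eq_cupPowTwo x j]

/-- **`Nᶜ H²ᶜ ∪ ζʲ ⊆ Nᶜ⁺ʲ H²ᶜ⁺²ʲ` for a divisor class `ζ ∈ N¹ H²`** on a smooth projective complex
variety (iterate the divisor case of Voisin II Prop. 9.20, the tree's THEOREM
`cupProduct_mem_algebraicClasses_one_right`). [cite: VoisinHodgeII2003, §9.2.4 Prop. 9.20]
[cite: Fulton1998, §2.3–2.4 and §19.2 Cor. 19.2] -/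
theorem cupProduct_cupPowTwo_mem_algebraicClasses {d : ℕ} {V : SchemeOver ℂ}
    (hV : IsSmoothProjective d V) {ζ : complexBetti V 2} (hζ : ζ ∈ algebraicClasses V 1)
    {c : ℕ} {y : complexBetti V (2 * c)} (hy : y ∈ algebraicClasses V c) :
    ∀ (j : ℕ) {t : ℕ} (ht : c + j = t) (h2 : 2 * c + 2 * j = 2 * t),
      cupProduct h2 y (cupPowTwo ζ j) ∈ algebraicClasses V t
  | 0, t, ht, h2 => by
    subst ht
    have e : cupProduct h2 y (cupPowTwo ζ 0) = y := cupProduct_one' ℂ _ _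
    rw [e]
    exact hy
  | j + 1, t, ht, h2 => by
    subst ht
    have ih := cupProduct_cupPowTwo_mem_algebraicClasses hV hζ hy j rfl (by ring)
    rw [cupPowTwo_succ, ← cupProduct_assoc (show 2 * c + 2 * j = 2 * (c + j) by ring)
      (two_mul_add_two j) (two_mul_add_two_mul (c + j) 1) h2]
    exact cupProduct_mem_algebraicClasses_one_right hV ih hζ

/-- Degree bookkeeping for the expansions `Σ_{b < B} q^* x_b ∪ ζᵇ` in degree `2p`, `B ≤ p + 1`. [folklore] -/
private theorem two_mul_sub_add' (p : ℕ) {B : ℕ} (hBp : B ≤ p + 1) (b : Fin B) :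
    2 * (p - b) + 2 * (b : ℕ) = 2 * p := by
  have := b.2; omega

/-! ## The hyperplane class of the total space and the ascent -/

/-- **A rational algebraic divisor class on `E` restricting non-trivially along every closed immersion
`ℙʳ ⟶ E` (`r ≥ 1`)**: `ζ = emb^* h` for a projective embedding `emb : E ⟶ ℙᴺ` and the rational generator
`h` of `H²(ℙᴺ(ℂ); ℂ)`. [cite: VoisinHodgeI2002, §7.1.1 and Lemma 7.32] -/
theorem exists_isRationalClass_lhClass {n r : ℕ} {E : SchemeOver ℂ} (hE : IsSmoothProjective (n + r) E) :
    ∃ ζ : complexBetti E 2, IsRationalClass ζ ∧ ζ ∈ algebraicClasses E 1 ∧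
      (1 ≤ r → ∀ ι : Motives.projectiveSpace r ℂ ⟶ E, IsClosedImmersion ι.left →
        complexBetti.map ι 2 ζ ≠ 0) := by
  obtain ⟨N, emb, hemb⟩ := hE.isProjectiveOver
  haveI := hemb
  have hP : IsSmoothProjective N (Motives.projectiveSpace N ℂ) := isSmoothProjective_projectiveSpace' N
  obtain ⟨h, hhrat, hh⟩ := exists_isRationalClass_forall_eq_smul_projectiveSpace N
  have hζrat : IsRationalClass (complexBetti.map emb 2 h) := hhrat.map (Motives.AlgPoints.mapContinuous (L := ℂ) emb)
  -- `ζ = emb^* h` is a rational `(1,1)`-class, hence algebraic (Lefschetz `(1,1)`)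
  have hh11 : IsOfHodgeType N (Motives.projectiveSpace N ℂ) 2 1 1 h :=
    isOfHodgeType_of_mem_algebraicClasses_of_isSmoothProjective hP 1
      (by rw [algebraicClasses_projectiveSpace_eq_top]; exact Submodule.mem_top)
  refine ⟨complexBetti.map emb 2 h, hζrat,
    lefschetzOneOne_rational_holds hE _ hζrat (hh11.map_of_isSmoothProjective hE hP emb), fun hr ι hι ↦ ?_⟩
  haveI := hι
  have hN : 1 ≤ N := le_trans (show 1 ≤ n + r by omega) (le_of_isClosedImmersion_projectiveSpace hE emb)
  have h1 : Module.finrank ℂ (complexBetti (Motives.projectiveSpace N ℂ) 2) = 1 :=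
    finrank_complexBetti_projectiveSpace_two_mul_eq_one N (p := 1) hN
  haveI : Nontrivial (complexBetti (Motives.projectiveSpace N ℂ) 2) := Module.nontrivial_of_finrank_eq_succ h1
  obtain ⟨c, hc⟩ := exists_ne (0 : complexBetti (Motives.projectiveSpace N ℂ) 2)
  have hh0 : h ≠ 0 := by
    rintro rfl
    obtain ⟨z, hz⟩ := hh c
    exact hc (by rw [hz, smul_zero])
  exact ZariskiProjectiveBundle.map_two_ne_zero_of_isClosedImmersion hr emb hh0 ι

/-- **PB-LH, direction `HC(X) ⇒ HC(E)`.** For a Zariski-locally trivial `ℙʳ`-bundle `q : E ⟶ X` of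
smooth projective varieties (`dim X = n`, `dim E = n + r`) on which the cup product preserves Hodge types,
`HodgeConjectureFor n X → HodgeConjectureFor (n + r) E`. [cite: VoisinHodgeI2002, §7.3.3 Lemma 7.32]
[cite: Lazarsfeld2004PositivityII, Ex. 7.1.5 (7.5)] -/
theorem hodgeConjectureFor_projectiveBundle {n r : ℕ} {X E : SchemeOver ℂ} (q : E ⟶ X)
    (hX : IsSmoothProjective n X) (hE : IsSmoothProjective (n + r) E)
    (htriv : IsZariskiProjectiveBundle r q) (hcup : CupPreservesHodgeType (n + r) E)
    (hXHC : HodgeConjectureFor n X) : HodgeConjectureFor (n + r) E := by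
  classical
  -- `q` is smooth, hence flat, between locally Noetherian schemes: `q^*` preserves algebraic classes
  haveI : SmoothOfRelativeDimension r q.left := htriv.smoothOfRelativeDimension
  haveI : Smooth q.left := SmoothOfRelativeDimension.smooth r q.left
  haveI : IsLocallyNoetherian E.left := IsSmoothProjective.isLocallyNoetherian_holds hE
  haveI : IsLocallyNoetherian X.left := IsSmoothProjective.isLocallyNoetherian_holds hX
  obtain ⟨ζ, hζrat, hζalg, hζres⟩ := exists_isRationalClass_lhClass (n := n) (r := r) hE
  have hζ11 : IsOfHodgeType (n + r) E 2 1 1 ζ :=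
    isOfHodgeType_of_mem_algebraicClasses_of_isSmoothProjective hE 1 hζalg
  -- `ζʲ` is of Hodge type `(j, j)`
  have hζpow : ∀ j : ℕ, IsOfHodgeType (n + r) E (2 * j) j j (cupPowTwo ζ j) := by
    intro j
    induction j with
    | zero =>
      exact isOfHodgeType_of_mem_algebraicClasses_of_isSmoothProjective hE 0
        (by rw [cupPowTwo_zero, algebraicClasses_zero]; exact Submodule.mem_top)
    | succ j ih =>
      rw [cupPowTwo_succ]
      exact hcup (two_mul_add_two j) ih hζ11
  refine ⟨nonempty_hodgeModel_holds hE, fun p y hy hpp ↦ ?_⟩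
  -- Leray–Hirsch expansion of `y`, reordered as `Σ_b q^* x_b ∪ ζᵇ`
  obtain ⟨x, hx⟩ := ZariskiProjectiveBundle.exists_expansion q hX htriv ζ hζres p y
  have hBp : min r p + 1 ≤ p + 1 := by omega
  have e : y = ∑ b : Fin (min r p + 1),
      cupProduct (two_mul_sub_add' p hBp b)
        (complexBetti.map q (2 * (p - (b : ℕ))) (x b)) (cupPowTwo ζ b) := by
    rw [hx]
    refine Finset.sum_congr rfl fun b _ ↦ ?_
    rw [cupProduct_gradedComm_holds ℂ (Motives.ComplexPoints E)
        (show 2 * (b : ℕ) + 2 * (p - (b : ℕ)) = 2 * p by omega)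
        (two_mul_sub_add' p hBp b),
      cupPow_eq_cupPowTwo,
      show ((-1 : ℂ) ^ (2 * (b : ℕ) * (2 * (p - (b : ℕ))))) = 1 from
        Even.neg_one_pow ⟨(b : ℕ) * (2 * (p - (b : ℕ))), by ring⟩, one_smul]
  -- the rational Hodge maps `G_b = q^*(·) ∪ ζᵇ : H^{2(p-b)}(X) → H^{2p}(E)`
  let G : ∀ b : Fin (min r p + 1), complexBetti X (2 * (p - (b : ℕ))) →ₗ[ℂ] complexBetti E (2 * p) :=
    fun b ↦ (cupProduct (two_mul_sub_add' p hBp b)).flip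
        (cupPowTwo ζ b) ∘ₗ (complexBetti.map q (2 * (p - (b : ℕ)))).hom
  have hG : ∀ (b : Fin (min r p + 1)) (u : complexBetti X (2 * (p - (b : ℕ)))),
      G b u = cupProduct (two_mul_sub_add' p hBp b)
        (complexBetti.map q (2 * (p - (b : ℕ))) u) (cupPowTwo ζ b) := fun b u ↦ rfl
  obtain ⟨a, ha, hya⟩ := exists_isRationalClass_isOfHodgeType_eq_sum hE (ι := Fin (min r p + 1))
    (m := fun _ ↦ n) (d := fun b ↦ p - (b : ℕ)) (Y := fun _ ↦ X) (fun _ ↦ hX) p (fun b ↦ (b : ℕ))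
    (fun b ↦ by have := b.2; show p - (b : ℕ) + b = p; omega) G
    (fun b u hu ↦ by
      rw [hG]; exact (hu.map (Motives.AlgPoints.mapContinuous (L := ℂ) q)).cup _ (hζrat.cupPowTwo b))
    (fun b a' c' u _ hu ↦ by rw [hG]; exact hcup _ (hu.map_of_isSmoothProjective hE hX q) (hζpow b))
    hy hpp (by rw [e]; exact Submodule.sum_mem _ fun b _ ↦
      Submodule.mem_iSup_of_mem b (LinearMap.mem_range.2 ⟨x b, rfl⟩))
  rw [hya]
  refine Submodule.sum_mem _ fun b _ ↦ ?_
  rw [hG]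
  have halg : a b ∈ algebraicClasses X (p - (b : ℕ)) := hXHC.2 _ _ (ha b).1 (ha b).2
  exact cupProduct_cupPowTwo_mem_algebraicClasses hE hζalg
    (map_mem_algebraicClasses_of_flat q halg) b (by have := b.2; omega) _

/-! ## Unconditional rungs -/

/-- **Every Zariski `ℙʳ`-bundle over a curve, surface or threefold satisfies the Hodge conjecture**
(any `r`, so any dimension `n + r`; the base by Lefschetz `(1,1)` + hard Lefschetz,
`hodgeConjectureFor_of_dim_le_three_holds`). [cite: VoisinHodgeI2002, §7.3.3 Lemma 7.32]
[cite: VoisinHodgeI2002, §11.3 (Hodge conjecture in dimension ≤ 3)] -/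
theorem hodgeConjectureFor_of_base_le_three {n r : ℕ} {X E : SchemeOver ℂ} (q : E ⟶ X)
    (hX : IsSmoothProjective n X) (hE : IsSmoothProjective (n + r) E) (htriv : IsZariskiProjectiveBundle r q)
    (hn : n ≤ 3) : HodgeConjectureFor (n + r) E :=
  hodgeConjectureFor_projectiveBundle q hX hE htriv
    (cupPreservesHodgeType_of_hodgeModel hE (Classical.choice (nonempty_hodgeModel_holds hE)))
    (hodgeConjectureFor_of_dim_le_three_holds hn hX)

/-- **Every Zariski `ℙʳ`-bundle over `ℙᴺ` satisfies the Hodge conjecture** (the base by the tree's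
`hodgeConjectureFor_projectiveSpace`). [cite: VoisinHodgeI2002, §7.3.3 Lemma 7.32] -/
theorem hodgeConjectureFor_of_base_projectiveSpace {N r : ℕ} {E : SchemeOver ℂ}
    (q : E ⟶ Motives.projectiveSpace N ℂ) (hE : IsSmoothProjective (N + r) E)
    (htriv : IsZariskiProjectiveBundle r q) : HodgeConjectureFor (N + r) E :=
  hodgeConjectureFor_projectiveBundle q (isSmoothProjective_projectiveSpace' N) hE htriv
    (cupPreservesHodgeType_of_hodgeModel hE (Classical.choice (nonempty_hodgeModel_holds hE)))
    (hodgeConjectureFor_projectiveSpace N)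

/-- **A two-step tower of Zariski projective bundles `E₂ → E₁ → X` over a base satisfying the Hodge
conjecture satisfies it** (iterate). [cite: VoisinHodgeI2002, §7.3.3 Lemma 7.32] -/
theorem hodgeConjectureFor_tower₂ {n r₁ r₂ : ℕ} {X E₁ E₂ : SchemeOver ℂ}
    (q₁ : E₁ ⟶ X) (q₂ : E₂ ⟶ E₁) (hX : IsSmoothProjective n X) (hE₁ : IsSmoothProjective (n + r₁) E₁)
    (hE₂ : IsSmoothProjective (n + r₁ + r₂) E₂) (h₁ : IsZariskiProjectiveBundle r₁ q₁)
    (h₂ : IsZariskiProjectiveBundle r₂ q₂) (hXHC : HodgeConjectureFor n X) :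
    HodgeConjectureFor (n + r₁ + r₂) E₂ :=
  hodgeConjectureFor_projectiveBundle q₂ hE₁ hE₂ h₂
    (cupPreservesHodgeType_of_hodgeModel hE₂ (Classical.choice (nonempty_hodgeModel_holds hE₂)))
    (hodgeConjectureFor_projectiveBundle q₁ hX hE₁ h₁
      (cupPreservesHodgeType_of_hodgeModel hE₁ (Classical.choice (nonempty_hodgeModel_holds hE₁))) hXHC)

end ZariskiProjectiveBundle

end Literature.AlgebraicGeometry.HodgeTheory

end
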